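import Summits.CriticalPhenomena.PercolationContinuityZ3.Theorems.Transplant.SkelNeg1Closure
import Summits.CriticalPhenomena.PercolationContinuityZ3.Theorems.Transplant.SkelKitResiduesHabN
import HarnessLib

/-!
# N1 (the {±1} node): THE PARTIAL CLOSURE FROM THE THREE RESIDUES AT AN ABSTRACT SCHEME — `PlanarSkeletonNeg.samePDropOfSkeletonNeg₁_of_residuesN`:
# the single-type target follows once, for all p-free constants `K₀ δ δ₂ δr` (with bounds), every one-type `PlanarSkeletonNeg Φ` of subexponential growth,
# `0 < p < 1`, uniqueness, Φ2, `θ_t(p) > 0`, the LEVEL-1 side names `δI ∈ (0,1)`, `m₀`, receives the Step-I″ record `D` with its facts, and returns admissible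
# `Sz`, `SMn` and, at every `q ∈ [p/2, p]` where the Step-I″ family over `indexNP {t} Sz SMn` holds with accuracy `δI` under Φ2: an ANCHORED-CELLS SCHEME
# `Γ : CellGeom V A` rooted at `t` with `K₀ ≤ Γ.K`, face data `FD`, level data `LD`, the six geometries, a `Lip` window map `ψ`, and the three residues
# `Skel.RootOblT … δr`, `Skelφ.FaceOblR G ψ … δ₂`, `Skel.ReachOblRHN G Skel.nmaxN … δ` at `⟨Γ, q, δ⟩`

Why ABSTRACT (design owner): the N1 cells are hp-8's FINE two-unit cells over `ψ = fineSkel∘φ` (NEG-SCOPE B.4) whose scheme-geometry instantiation is being typed (B.5);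
this file fixes the residue-level target NOW, independent of the builder's name — the constants are produced here exactly as in D″'s
`samePDropOfSkeletonSign_of_concSG_residuesRH` (`δ := δCN nmaxN 2⁻³⁵`, `δ₂` from `apply_step_subgraph_UP`, `δr n` from `chain_edge_subgraph_UP`, `K₀` with
`(1−δ₂)^{K₀} < 2⁻³⁵`), and `KitAtRun` comes from p5-g8's `Skelφ.kitAtRun_of_oblRHN`.
builds on p205010 (kernel theorem, internal audit signed; external expert review pending) — nothing here uses p205010; the node `SamePDropOfSkeletonNeg₁` stays OPEN
(conditional assembly).  Lane `prim-bschramm`, seat `prim-bschramm-p3` (gen 8; design owner); helper file (`--supports stmt-CriticalPhenomena-4575`); NEG-SCOPE §5 / B.2.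
[cite: KozmaNitzan2024, §4 Theorem 6 (pp. 25–31), Lemmas 10–12; §1 p. 2 (approach 1)] [cite: MartineauTassion2017, §3.4, §4]
-/

noncomputable section

open MeasureTheory ProbabilityTheory
open scoped ENNReal Classical

namespace Summit.CriticalPhenomena.PercolationContinuityZ3.Theorems.Transplant

open Literature.Probability.Percolation Literature.Probability.LatticeModels SimpleGraph KNCells KNLevels
open Literature.Barriers.CriticalPhenomena (HasExponentialGrowth)

namespace PlanarSkeletonNeg

/-- **THE N1 PARTIAL CLOSURE, run-restricted habitat form, abstract scheme.**  See the module docstring for the reading of the hypothesis.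
[cite: KozmaNitzan2024, §4 Theorem 6 (pp. 25–31); §1 p. 2 (approach 1)] -/
theorem samePDropOfSkeletonNeg₁_of_residuesN
    (hres : ∀ (K₀ : ℕ) (δ δ₂ : ℝ) (δr : ℕ → ℝ), 0 < δ → δ ≤ 1 → 0 < δ₂ → δ₂ ≤ 1 → (∀ n, 0 < δr n ∧ δr n ≤ 1) →
      ∀ {V : Type} [DecidableEq V] [Countable V] (G : SimpleGraph V) [G.LocallyFinite] (Φ : PlanarSkeletonNeg G),
        ¬ HasExponentialGrowth G → ∀ t ∈ Φ.types, Φ.types = {t} → ∀ p : unitInterval, 0 < (p : ℝ) → (p : ℝ) < 1 →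
          (∀ᵐ ω ∂bondPercolation G p, numInfiniteClusters ω ≤ 1) → ∀ hC : Φ.CylSubcritical p, 0 < theta G t p →
            ∃ (δI : ℝ) (m₀ : ℕ), 0 < δI ∧ δI < 1 ∧
              ∀ D : Skelφ.StepI.DataN V, m₀ ≤ D.k → 1 ≤ D.k → D.k ≤ D.M₀ → D.R = Skelφ.fatRadius Φ.frame hC →
                D.Λ = Skelφ.fatSeq Φ.frame hC → (∀ M, D.M₀ ≤ M → ∀ n, D.n₁ M ≤ n → D.EqGeom G Φ.φ t M n) →
                ∃ (Sz : Finset ℕ) (SMn : Finset (ℕ × ℕ)), (∀ M ∈ Sz, D.M₀ ≤ M) ∧ (∀ q ∈ SMn, D.M₀ ≤ q.1 ∧ D.n₁ q.1 ≤ q.2) ∧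
                  ∀ q : unitInterval, (p : ℝ) / 2 ≤ q → (q : ℝ) ≤ p →
                    (∀ i ∈ Skelφ.StepI.indexNP {t} Sz SMn,
                      1 - δI < (bondPercolation G q).real (Skelφ.StepI.eventN G Φ.φ D i)) →
                    Φ.CylSubcritical q →
                      ∃ (A : Type) (Γ : CellGeom V A) (FD : FaceData V A) (LD : LevelData V A) (ψ : V → Site 2),
                        Γ.root = t ∧ K₀ ≤ Γ.K ∧ Skelφ.Lip G ψ ∧
                        RunGeom G Γ ∧ AnchGeom Γ ∧ SepGeom₂ G Γ ∧ ExitGeom G Γ ∧ StepsGeom Γ FD ∧ LevelGeom G Γ FD LD ∧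
                        Skel.RootOblT G (⟨Γ, q, δ⟩ : KSchA V A) Φ.Δ δr ∧
                        Skelφ.FaceOblR G ψ (⟨Γ, q, δ⟩ : KSchA V A) FD Φ.Δ δ₂ ∧
                        Skel.ReachOblRHN G Skel.nmaxN (⟨Γ, q, δ⟩ : KSchA V A) FD Φ.Δ δ) :
    SamePDropOfSkeletonNeg₁ := by
  refine samePDropOfSkeletonNeg₁_of_stepI_run fun {V} _ _ G _ Φ hg t ht h1 p hp0 hp1 hU hC hθ => ?_
  -- the p-free constants (`Φ.Δ` is the degree parameter; one chain accuracy for every corridor-chain length `≤ nmaxN`)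
  have hε' : (0 : ℝ) < (1 / 2) ^ 35 := by positivity
  have hΔ : ∀ v, G.degree v ≤ Φ.Δ := Φ.degree_le
  obtain ⟨δ, hδ0, hδ1, hchainH⟩ : ∃ δ : ℝ, 0 < δ ∧ δ ≤ 1 ∧ ∀ n ≤ Skel.nmaxN, ∀ (q : unitInterval), (q : ℝ) < 1 →
      ∀ (G' : SimpleGraph V) [G'.LocallyFinite], G' ≤ G →
        ∀ (Wt : Sym2 V → unitInterval) (s : Fin (n + 1) → TStep G') (T' : Fin (n + 1) → Finset V) (η : ℝ),
        (∀ i : Fin (n + 1), (s i).L.o = (s 0).L.o) →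
        (∀ i : Fin n, T' (Fin.castSucc i) ⊆ (s i.succ).L.X 0) →
        (∀ i : Fin (n + 1), T' i ⊆ (s i).T) →
        (∀ i : Fin (n + 1), (s i).KitsAt Wt q Φ.Δ δ) →
        η ≤ δ / 2 →
        (∀ i : Fin (n + 1), (prodBernoulli Wt).real (⋃ t ∈ (s i).T \ T' i, openConn (s 0).L.o t) ≤ η) →
        1 - δ < (prodBernoulli Wt).real (s 0).L.reachB →
          1 - (1 / 2 : ℝ) ^ 35 < (prodBernoulli Wt).real (⋃ t ∈ T' (Fin.last n), openConn (s 0).L.o t) :=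
    ⟨Skelφ.δCN G hΔ Skel.nmaxN ((1 / 2) ^ 35), Skelφ.δCN_pos G hΔ _ _, Skelφ.δCN_le_one G hΔ _ _,
      fun n hn q hq1 G' _ hG' => Skelφ.δCN_spec G hΔ hε' hn hq1 G' hG'⟩
  obtain ⟨δ₂, hδ₂0, hδ₂1, hstep⟩ := SkelConc.apply_step_subgraph_UP G hΔ (half_pos hδ0)
  have hrc := fun n : ℕ => SkelConc.chain_edge_subgraph_UP G hΔ n hδ0
  choose δr hδr0 hδr1 hchainr using hrc
  obtain ⟨K₀, hK₀⟩ := exists_pow_lt_of_lt_one hε' (show 1 - δ₂ < 1 by linarith)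
  -- the instance at `p`
  obtain ⟨δI, m₀, hδI, hδI1, hS⟩ := hres K₀ δ δ₂ δr hδ0 hδ1 hδ₂0 hδ₂1 (fun n => ⟨hδr0 n, hδr1 n⟩) G Φ hg t ht h1 p hp0 hp1 hU hC hθ
  refine ⟨δI, m₀, hδI, hδI1, fun D hk₀ hk₁ hkM hR hΛ hgeom => ?_⟩
  obtain ⟨Sz, SMn, hSz, hSMn, hB⟩ := hS D hk₀ hk₁ hkM hR hΛ hgeom
  refine ⟨Sz, SMn, hSz, hSMn, fun q hq1 hq2 hcq hCq => ?_⟩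
  -- (B) at `q`
  have hq1' : (q : ℝ) < 1 := lt_of_le_of_lt hq2 hp1
  obtain ⟨A, Γ, FD, LD, ψ, hroot, hK, hlipψ, hrun, hanch, hsep, hexit, hsteps, hlev, hrootO, hfaceO, hreachO⟩ := hB q hq1 hq2 hcq hCq
  refine ⟨A, ⟨Γ, q, δ⟩, FD, LD, (1 / 2) ^ 35, δ₂, hroot, rfl, hrun, hanch, hsep, hexit, hsteps, hlev, hδ1, hε'.le, hδ₂1, ?_, ?_⟩
  · -- `4((1-δ₂)^K + 2⁻³⁵) ≤ 2⁻³²` since `K ≥ K₀`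
    have hKpow : (1 - δ₂) ^ Γ.K ≤ (1 / 2 : ℝ) ^ 35 := (pow_le_pow_of_le_one (by linarith) (by linarith) hK).trans hK₀.le
    have h32 : (4 : ℝ) * ((1 / 2) ^ 35 + (1 / 2) ^ 35) = (1 / 2) ^ 32 := by norm_num
    show 4 * ((1 - δ₂) ^ Γ.K + (1 / 2 : ℝ) ^ 35) ≤ (1 / 2) ^ 32
    linarith
  · exact Skelφ.kitAtRun_of_oblRHN (S := ⟨Γ, q, δ⟩) hlipψ le_rfl
      (fun c Rπ => hstep q hq1' (Skel.winGraph G c Rπ) (Skel.winGraph_le G c Rπ))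
      (fun n hn Ω => hchainH n hn q hq1' (Skel.winGraphIn G Ω) (Skel.winGraphIn_le G Ω))
      (fun n c Rπ => hchainr n q hq1' (Skel.winGraph G c Rπ) (Skel.winGraph_le G c Rπ)) hrootO hfaceO hreachO

end PlanarSkeletonNeg

end Summit.CriticalPhenomena.PercolationContinuityZ3.Theorems.Transplant

end
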